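import Literature.MathematicalPhysics.QuantumFieldTheory.Balaban1983to89.B9Ineq349SiteFromBlocks

/-!
# `Balaban1983to89.B9Ineq349SiteThresholdRate` — T. Bałaban, *Propagators for lattice gauge theories in a background field*, Commun. Math. Phys. **99** (1985)
# 389–434 [Balaban1985BackgroundPropagators], (3.49) p. 399 («using again Lemma 2.1»): THE (3.49) THRESHOLD FACT OF `B9Ineq349SiteFromBlocks` WITH ITS
# DECAY RATE CLOSED — `θ = min(δ₀, δ₁)∕8` — instead of ∃-hidden

[4] = T. Bałaban, *Propagators and renormalization transformations for lattice gauge theories. II*, Commun. Math. Phys. **96** (1984) 223–250 [`Balaban1984PropagatorsII`].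

statement-level skeleton of published theorems with citation tags; proofs where landed; nothing here is a claim about the Yang–Mills mass gap

THE PRINT.  [B9] p. 399: *«For the operator P = I − R we obtain, using again Lemma 2.1, |P(U; y, y′)| ≦ O(1)(Lʲη)⁻²(L^{j′}η)^{−d} exp(−½δ₀ d(y, y′)) (3.49)»*;
[4] Lemma 2.1 (2.60)–(2.63) p. 234.

WHY THIS FILE (dag-n06-i gen 18; dag-n06-d g10 ASK-4 «(3.49) RATE EXPOSED», 2026-08-28).  `B9Ineq349SiteFromBlocks.exists_threshold_349` (gen 6) hides its
rate `θ` behind `∃ θ, 0 < θ ∧ θ ≤ δ₀`.  The N06 certificate (editions ≥ 24) displays the rate CASCADE below (3.49) — `rT ≤ δP`, `δT12 + 2σS + 3·αF·δ₀′ ≤ rT`,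
… — with CLOSED rates in the pin primitives (house style: thresholds ∃, rates closed), so an ∃-hidden (3.49) rate cannot be composed with the displayed
rows-20–21 schemas.  The proof's rate IS closed: `θ = ½δ` with `δ = min(δ₀, δ₁)∕4`.  This file restates the theorem with `θ := min δ₀ δ₁ ∕ 8` in the
conclusion (same proof, verbatim); the home file's ∃-form is the special case `θ := min δ₀ δ₁ ∕ 8 ≤ δ₀` (not restated: dedup).  A NEW file because the
home file is at the 400-line cap.

WHAT IS PROVED (sorry-free; the gen-6 proof verbatim: [4] Lemma 2.1 on the member's torus at `(δ, ½)`, the (2.60) scale transfers with the largeness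
`L⁴, L^{d′}, L² ≤ e^{½δ·RM}` above the threshold, the (2.63) convolution, g0's three-factor power counting `B9Ineq349.comp3_kernel_pq`, the dictionary
`fineEntryS_le_comp3_of_schemas`).
* §1 ★★ `exists_threshold_349_rate` — `∃ M₃ Cg > 0, ∀ i` above `M₃`, `∀ 𝔸 parS Gp U B₀ B₁ ≥ 0`, the three block-complete schemas ⟹
  `fineEntryS i (P349Y i parS Gp) U s s′ n ≤ B₀B₁B₀·Cg·pref4inv·(len s′)^{−d′}·e^{−(min δ₀ δ₁ ∕ 8)·d(s,s′)}`.

HONEST SCOPE.  Bookkeeping of numerics already in the tree; nothing of [B9] asserted; COUNT-NEUTRAL; N06 NOT discharged; one finite 𝕋^{d+1} programme at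
fixed ε — nothing continuum, nothing OS, nothing about the mass gap.  Cell `pub-ymgap` (HUMAN RULING D-0062), node N06 [B9], seat `pub-ymgap-dag-n06-i`
(gen 18), 2026-08-28; a NEW file.
-/

namespace Literature.MathematicalPhysics.QuantumFieldTheory.Balaban1983to89.B9Ineq349SiteThresholdRate

open Node00
open B6KLevelCensusIndexV1 (KIdx)
open B6Geom246MultiLevelBox (bset blkOf)
open B6Geom246MultiLevelTorus (geomT lemma21_torus)
open B6Ineq2142KLevelV1 (β lvl beta_level)
open B6Prop22KLevelTorusCensus (KTIdx)
open B6Prop22KLevelTorusCensusEta (nKT nKT_pos)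
open B6Ineq288MultiLevelTorus (geoBT geoBT_len geoBT_dist geoBT_M geoBT_L geoBT_eta geoBT_RM dist_nonneg_geoBT dist_symm_geoBT triangle_geoBT
  ineq260_geoBT)
open B6Ineq261LevelGap (K261 K261_nonneg theta_lt_one_of_log)
open B6Cor28 (comp3 TransferL TransferR Conv3 transfer_of_260)
open B9Ineq349 (powL powR comp3_kernel_pq conv3_of_261 transferL_mono powR_bounds pref4inv_eq_rpow)
open B9Ineq349SiteReading (fineEntryS p349SiteY fineKernelOfSiteOp)
open B9Ineq349SiteComposite (lenB distB lenB_eq lenB_pos distB_nonneg etaS_pos Left342At Right342At Blk348At modelK₁ modelK₂ modelK₃ ea349 eb349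
  modelK₁_nonneg modelK₂_nonneg modelK₃_nonneg comp3_model_nonneg fineEntryS_le_comp3_of_schemas)
open B9Ineq349SiteFromBlocks (pow_ea349_eq_rpow pow_eb349_eq_rpow distB_triangle)
open B9PinMembersKLevelV1 (MemberY geo9Y bg9Y)
open scoped Matrix

noncomputable section

variable {d ℓ : ℕ} {hd : 1 ≤ d + 1} {hL : Odd (ℓ + 1) ∧ 1 < ℓ + 1} {b₀ b₁ : ℝ} {Mstar : ℕ}

/-! ## §1 ★★ (3.49) at one configuration for every member above a threshold — the rate CLOSED -/

/-- `t^m ≤ e^{E}` once `m·log t ≤ E` (`t > 0`). [cite: Balaban1984PropagatorsII, (2.59) p.233, bookkeeping] -/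
private theorem rpow_le_exp_of_mul_log_le {t m E : ℝ} (ht : 0 < t) (h : m * Real.log t ≤ E) : t ^ m ≤ Real.exp E := by
  rw [Real.rpow_def_of_pos ht]
  exact Real.exp_le_exp.2 (by rw [mul_comm]; exact h)

set_option maxHeartbeats 400000 in
/-- ★★ **(3.49) AT ONE CONFIGURATION FROM THE BLOCK-COMPLETE SCHEMAS, EVERY MEMBER ABOVE A THRESHOLD, WITH THE RATE CLOSED** (`θ = min(δ₀,δ₁)∕8`):
for `δ₀, δ₁ > 0` there are `M₃, C_g > 0` (functions of `d, L, δ₀, δ₁` only) such that for every index `i` with `L·M_h ≥ M₃`, every fibre `𝔸`, all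
`parS, Gp, U` and `B₀, B₁ ≥ 0`, the schemas `Left342At`, `Right342At` (with `B₀, δ₀`) and `Blk348At` (with `B₁, δ₁`) imply
`fineEntryS i (P349Y i parS Gp) U y y′ n ≤ B₀B₁B₀·C_g·[1, (Lʲη)⁻¹, (Lʲη)⁻¹, (Lʲη)⁻²]ₙ·(L^{j′}η)^{−d′}·e^{−(min(δ₀,δ₁)∕8)·d(y,y′)}` for all blocks `y, y′` and entries
`n` — `B9Ineq349SiteFromBlocks.exists_threshold_349` with its `∃ θ` replaced by the proof's value (dag-n06-d ASK-4: the certificate's rate cascade needs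
a closed lower bound for the (3.49) rate).
[cite: Balaban1985BackgroundPropagators, (3.49) p.399 («using again Lemma 2.1»); Balaban1984PropagatorsII, Lemma 2.1 (2.60)–(2.63) p.234, (2.88) p.238] -/
theorem exists_threshold_349_rate {δ₀ δ₁ : ℝ} (hδ₀ : 0 < δ₀) (hδ₁ : 0 < δ₁) :
    ∃ M₃ Cg : ℝ, 0 < M₃ ∧ 0 < Cg ∧
      ∀ i : KIdx d ℓ hd hL b₀ b₁, M₃ ≤ ((ℓ : ℝ) + 1) * i.Mh →
        ∀ {𝔸 : Type} [NormedRing 𝔸] [NormedAlgebra ℂ 𝔸] [CompleteSpace 𝔸]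
          (parS : SiteParY 𝔸 i) (Gp : SiteOpY 𝔸 i) (U : CfgY 𝔸 i) {B₀ B₁ : ℝ}, 0 ≤ B₀ → 0 ≤ B₁ →
          Left342At i parS Gp U B₀ δ₀ → Right342At i parS Gp U B₀ δ₀ → Blk348At i parS Gp U B₁ δ₁ →
          ∀ (n : Fin 4) (s s' : BlkY i), fineEntryS i (P349Y i parS Gp) U s s' n ≤
            B₀ * B₁ * B₀ * Cg * B9.pref4inv (lenB i s) n * lenB i s' ^ (-((d + 1 : ℕ) : ℝ)) * Real.exp (-(min δ₀ δ₁ / 8 * distB i s s')) := by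
  have hℓ1 : 1 ≤ ℓ := by have := hL.2; omega
  have hL0 : (0 : ℝ) < (ℓ : ℝ) + 1 := by positivity
  have hL1 : (1 : ℝ) ≤ (ℓ : ℝ) + 1 := by linarith [(Nat.cast_nonneg ℓ : (0 : ℝ) ≤ ℓ)]
  have hlog : Real.log ((ℓ : ℝ) + 1) ≤ (ℓ : ℝ) + 1 := (Real.log_le_sub_one_of_pos hL0).trans (by linarith)
  have hlog0 : 0 ≤ Real.log ((ℓ : ℝ) + 1) := Real.log_nonneg hL1
  -- the rate of Lemma 2.1: `δ = min(δ₀, δ₁)/4`, `α = ½`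
  obtain ⟨δ, hδ⟩ : ∃ δ : ℝ, δ = min δ₀ δ₁ / 4 := ⟨_, rfl⟩
  have hδpos : 0 < δ := by rw [hδ]; exact div_pos (lt_min hδ₀ hδ₁) (by norm_num)
  have hδa : δ + 2 * (1 / 2 * δ) ≤ δ₀ := by
    have : min δ₀ δ₁ ≤ δ₀ := min_le_left _ _
    rw [hδ]; linarith
  have hδb : δ + 1 / 2 * δ ≤ δ₁ := by
    have : min δ₀ δ₁ ≤ δ₁ := min_le_right _ _
    rw [hδ]; linarith
  -- the (2.59)-type threshold for (2.61) at `(δ, ½)` and the largeness threshold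
  obtain ⟨N₁, hN₁⟩ : ∃ N₁ : ℕ, N₁ = ⌈8 * ((d : ℝ) + 1) * ((ℓ : ℝ) + 1) / δ⌉₊ + 1 := ⟨_, rfl⟩
  have hN₁pos : 0 < N₁ := by rw [hN₁]; omega
  have hN₁ge : 8 * ((d : ℝ) + 1) * ((ℓ : ℝ) + 1) < δ * (N₁ : ℝ) := by
    have h : 8 * ((d : ℝ) + 1) * ((ℓ : ℝ) + 1) / δ < (N₁ : ℝ) := by
      rw [hN₁]; push_cast; exact lt_of_le_of_lt (Nat.le_ceil _) (by linarith)
    rw [div_lt_iff₀ hδpos] at h; linarith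
  have hθ1 : Real.exp (-(1 / 2 * δ)) * ((ℓ : ℝ) + 1) ^ ((2 * (d + 1 : ℕ) : ℝ) / N₁) < 1 := by
    refine theta_lt_one_of_log hL0 hN₁pos ?_
    push_cast
    have hd0 : (0 : ℝ) ≤ 2 * ((d : ℝ) + 1) := by positivity
    have h1 := mul_le_mul_of_nonneg_left hlog hd0
    have h2 : (0 : ℝ) ≤ ((d : ℝ) + 1) * ((ℓ : ℝ) + 1) := by positivity
    linarith
  obtain ⟨N₂, hN₂⟩ : ∃ N₂ : ℕ, N₂ = ⌈2 * ((d : ℝ) + 5) * ((ℓ : ℝ) + 1) / δ⌉₊ := ⟨_, rfl⟩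
  have hN₂ge : 2 * ((d : ℝ) + 5) * ((ℓ : ℝ) + 1) ≤ δ * (N₂ : ℝ) := by
    have h : 2 * ((d : ℝ) + 5) * ((ℓ : ℝ) + 1) / δ ≤ (N₂ : ℝ) := by rw [hN₂]; exact Nat.le_ceil _
    rw [div_le_iff₀ hδpos] at h; linarith
  obtain ⟨cL, hcL⟩ : ∃ cL : ℝ, cL = K261 N₁ (d + 1) ((ℓ : ℝ) + 1) 1 (1 / 2 * δ) := ⟨_, rfl⟩
  have hcL0 : 0 ≤ cL := by rw [hcL]; exact K261_nonneg (by positivity) zero_le_one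
  obtain ⟨M₃, hM₃⟩ : ∃ M₃ : ℝ, M₃ = max ((N₁ : ℝ) + 1) ((N₂ : ℝ) + 1) := ⟨_, rfl⟩
  have hM₃pos : 0 < M₃ := by rw [hM₃]; exact lt_max_of_lt_left (by positivity)
  obtain ⟨Cg, hCg⟩ : ∃ Cg : ℝ, Cg = ((ℓ : ℝ) + 1) ^ (4 : ℝ) * ((ℓ : ℝ) + 1) ^ ((d + 1 : ℕ) : ℝ) * ((ℓ : ℝ) + 1) ^ (2 : ℝ) * cL ^ 3 + 1 :=
    ⟨_, rfl⟩
  have hCgbase : 0 ≤ ((ℓ : ℝ) + 1) ^ (4 : ℝ) * ((ℓ : ℝ) + 1) ^ ((d + 1 : ℕ) : ℝ) * ((ℓ : ℝ) + 1) ^ (2 : ℝ) * cL ^ 3 := by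
    have := Real.rpow_nonneg hL0.le (4 : ℝ)
    have := Real.rpow_nonneg hL0.le ((d + 1 : ℕ) : ℝ)
    have := Real.rpow_nonneg hL0.le (2 : ℝ)
    positivity
  have hCgpos : 0 < Cg := by rw [hCg]; linarith
  refine ⟨M₃, Cg, hM₃pos, hCgpos, ?_⟩
  intro i hM 𝔸 _ _ _ parS Gp U B₀ B₁ hB₀ hB₁ hLe hRi h348 n s s'
  rw [show min δ₀ δ₁ / 8 = 1 / 2 * δ from by rw [hδ]; ring]
  -- the member's thresholds (`toKT i` is the torus index of the member)
  have hR1 : 1 ≤ i.R := le_trans (by omega) (toKT i).hR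
  have hNle : ∀ N : ℕ, (N : ℝ) + 1 ≤ ((ℓ : ℝ) + 1) * i.Mh → N + 1 ≤ i.R * ((ℓ + 1) * i.Mh) := by
    intro N hN
    have h1 : ((N + 1 : ℕ) : ℝ) ≤ (((ℓ + 1) * i.Mh : ℕ) : ℝ) := by push_cast; exact hN
    have h2 : N + 1 ≤ (ℓ + 1) * i.Mh := by exact_mod_cast h1
    exact h2.trans (Nat.le_mul_of_pos_left _ hR1)
  have hRM1 : N₁ + 1 ≤ (toKT i).R * ((ℓ + 1) * (toKT i).Mh) := hNle N₁ ((le_max_left _ _).trans (hM₃ ▸ hM))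
  have hRM2 : N₂ + 1 ≤ i.R * ((ℓ + 1) * i.Mh) := hNle N₂ ((le_max_right _ _).trans (hM₃ ▸ hM))
  -- Lemma 2.1 on the torus of the member at `(δ, ½)`: (2.61) with the repaired constant; (2.60) for `geoBT`
  obtain ⟨-, h261, -, -⟩ :=
    lemma21_torus i.D (toKT i).hMh (toKT i).hP hN₁pos hRM1 hδpos.le (α := 1 / 2) (by norm_num) (by norm_num) hθ1
  have h261B : ∀ y : BlkY i, ∑ y' : BlkY i, Real.exp (-(1 / 2 * δ * distB i y y')) ≤ cL := by
    rw [hcL]; exact fun y => h261 y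
  have h260B : B6RandomWalk.Ineq260 (geoBT (toKT i)) δ (1 / 2) := ineq260_geoBT (toKT i) (by positivity)
  -- the largeness `L⁴, L^{d′}, L² ≤ e^{½δ·RM}`, `RM = R·L·M_h − 1 ≥ N₂`
  have hge : (N₂ : ℝ) ≤ (i.R : ℝ) * (((ℓ : ℝ) + 1) * i.Mh) - 1 := by
    have : ((N₂ + 1 : ℕ) : ℝ) ≤ ((i.R * ((ℓ + 1) * i.Mh) : ℕ) : ℝ) := by exact_mod_cast hRM2
    push_cast at this; linarith
  have hE : ((d : ℝ) + 5) * Real.log ((ℓ : ℝ) + 1) ≤ 1 / 2 * δ * (geoBT (toKT i)).R * (geoBT (toKT i)).M := by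
    rw [mul_assoc (1 / 2 * δ), geoBT_RM]
    have hge' : (N₂ : ℝ) ≤ ((toKT i).R : ℝ) * (((ℓ : ℝ) + 1) * (toKT i).Mh) - 1 := hge
    have h3 := mul_le_mul_of_nonneg_left hge' (by positivity : (0 : ℝ) ≤ 1 / 2 * δ)
    have hd5 : (0 : ℝ) ≤ (d : ℝ) + 5 := by positivity
    have h4 := mul_le_mul_of_nonneg_left hlog hd5
    linarith
  have hl4 : (geoBT (toKT i)).L ^ (4 : ℝ) ≤ Real.exp (1 / 2 * δ * (geoBT (toKT i)).R * (geoBT (toKT i)).M) := by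
    rw [geoBT_L]; refine rpow_le_exp_of_mul_log_le hL0 (le_trans ?_ hE); nlinarith
  have hld : (geoBT (toKT i)).L ^ ((d + 1 : ℕ) : ℝ) ≤ Real.exp (1 / 2 * δ * (geoBT (toKT i)).R * (geoBT (toKT i)).M) := by
    rw [geoBT_L]; refine rpow_le_exp_of_mul_log_le hL0 (le_trans ?_ hE); push_cast; nlinarith
  have hl2 : (geoBT (toKT i)).L ^ (2 : ℝ) ≤ Real.exp (1 / 2 * δ * (geoBT (toKT i)).R * (geoBT (toKT i)).M) := by
    rw [geoBT_L]; refine rpow_le_exp_of_mul_log_le hL0 (le_trans ?_ hE); nlinarith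
  -- the scale transfers from (2.60): constants `L⁴`, `L^{d′}`, `L^{q} ≤ L²`
  have hLg : 1 ≤ (geoBT (toKT i)).L := by rw [geoBT_L]; exact hL1
  have hηg : 0 < (geoBT (toKT i)).eta := by rw [geoBT_eta]; exact inv_pos.2 (by exact_mod_cast nKT_pos (toKT i))
  have e4 : |(-(4 : ℝ))| = 4 := by norm_num
  have ed : |(-((d + 1 : ℕ) : ℝ))| = ((d + 1 : ℕ) : ℝ) := by rw [abs_neg]; exact abs_of_nonneg (Nat.cast_nonneg _)
  have hT₄ := (transfer_of_260 (geoBT (toKT i)).scale (geoBT (toKT i)).dist (geoBT (toKT i)).L (geoBT (toKT i)).eta (1 / 2 * δ)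
    (geoBT (toKT i)).R (geoBT (toKT i)).M (-(4 : ℝ)) hLg hηg (by rw [e4]; exact hl4) h260B).2
  have hTd := (transfer_of_260 (geoBT (toKT i)).scale (geoBT (toKT i)).dist (geoBT (toKT i)).L (geoBT (toKT i)).eta (1 / 2 * δ)
    (geoBT (toKT i)).R (geoBT (toKT i)).M (-((d + 1 : ℕ) : ℝ)) hLg hηg (by rw [ed]; exact hld) h260B).1
  rw [e4] at hT₄
  rw [ed] at hTd
  rw [← B6Cor28.len_eq_rpow] at hT₄ hTd
  have hlen : ∀ y : BlkY i, 0 < lenB i y := lenB_pos i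
  have hTq : TransferL (lenB i) (distB i) (1 / 2 * δ) (powR n) ((geoBT (toKT i)).L ^ (2 : ℝ)) := by
    obtain ⟨hq0, hq2⟩ := powR_bounds n
    have hq : |powR n| = powR n := abs_of_nonneg hq0
    have hL2 : (geoBT (toKT i)).L ^ powR n ≤ (geoBT (toKT i)).L ^ (2 : ℝ) := Real.rpow_le_rpow_of_exponent_le hLg hq2
    have hlq : (geoBT (toKT i)).L ^ |powR n| ≤ Real.exp (1 / 2 * δ * (geoBT (toKT i)).R * (geoBT (toKT i)).M) := by
      rw [hq]; exact hL2.trans hl2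
    have hT := (transfer_of_260 (geoBT (toKT i)).scale (geoBT (toKT i)).dist (geoBT (toKT i)).L (geoBT (toKT i)).eta (1 / 2 * δ)
      (geoBT (toKT i)).R (geoBT (toKT i)).M (powR n) hLg hηg hlq h260B).2
    rw [hq, ← B6Cor28.len_eq_rpow] at hT
    exact transferL_mono (lenB i) (distB i) (1 / 2 * δ) (powR n) _ _ hlen hL2 hT
  -- the convolution (2.63) from (2.61) and (2.54)
  have hconv : Conv3 (distB i) δ (cL ^ 3) ((1 - 1 / 2) * δ) :=
    conv3_of_261 (distB i) (distB_triangle i) δ (1 / 2) cL hδpos.le (by norm_num) h261B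
  -- the three kernel bounds (the model kernels, exactly)
  have hK₁ : ∀ y y₁ : BlkY i, |modelK₁ i B₀ δ₀ n y y₁| ≤ B₀ * lenB i y ^ powL n * Real.exp (-(δ₀ * distB i y y₁)) := by
    intro y y₁
    rw [abs_of_nonneg (modelK₁_nonneg hB₀ δ₀ n y y₁)]
    unfold modelK₁; rw [pow_ea349_eq_rpow (lenB i y) n]
  have hK₂ : ∀ y₁ y₂ : BlkY i, |modelK₂ i B₁ δ₁ y₁ y₂| ≤
      B₁ * lenB i y₁ ^ (-(4 : ℝ)) * lenB i y₂ ^ (-((d + 1 : ℕ) : ℝ)) * Real.exp (-(δ₁ * distB i y₁ y₂)) := by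
    intro y₁ y₂
    rw [abs_of_nonneg (modelK₂_nonneg hB₁ δ₁ y₁ y₂)]
    rfl
  have hK₃ : ∀ y₂ y' : BlkY i, |modelK₃ i B₀ δ₀ n y₂ y'| ≤ B₀ * lenB i y' ^ powR n * Real.exp (-(δ₀ * distB i y₂ y')) := by
    intro y₂ y'
    rw [abs_of_nonneg (modelK₃_nonneg hB₀ δ₀ n y₂ y')]
    unfold modelK₃; rw [pow_eb349_eq_rpow (lenB i y') n]
  -- the power counting
  have hLnn : 0 ≤ (geoBT (toKT i)).L := le_trans zero_le_one hLg
  have main := comp3_kernel_pq (lenB i) (distB i) (d + 1) (modelK₁ i B₀ δ₀ n) (modelK₂ i B₁ δ₁) (modelK₃ i B₀ δ₀ n)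
    (powL n) (powR n) B₀ B₁ B₀ δ₀ δ₁ δ₀ (1 / 2 * δ) δ ((geoBT (toKT i)).L ^ (4 : ℝ)) ((geoBT (toKT i)).L ^ ((d + 1 : ℕ) : ℝ))
    ((geoBT (toKT i)).L ^ (2 : ℝ)) (cL ^ 3) ((1 - 1 / 2) * δ) hlen (distB_nonneg i) (distB_triangle i) hB₀ hB₁ hB₀
    (Real.rpow_nonneg hLnn _) (Real.rpow_nonneg hLnn _) (Real.rpow_nonneg hLnn _) (by positivity) hδa hδb hδa hK₁ hK₂ hK₃ hT₄ hTd hTq hconv s s'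
  -- assembly
  have hdict := fineEntryS_le_comp3_of_schemas hB₀ hB₁ hLe hRi h348 n s s'
  have hpref : lenB i s ^ (powL n + powR n - 4) = B9.pref4inv (lenB i s) n := (pref4inv_eq_rpow (lenB i s) (hlen s) n).symm
  have hrate : (1 - 1 / 2) * δ = 1 / 2 * δ := by ring
  rw [geoBT_L] at main
  have hrest : 0 ≤ B9.pref4inv (lenB i s) n * lenB i s' ^ (-((d + 1 : ℕ) : ℝ)) * Real.exp (-(1 / 2 * δ * distB i s s')) := by
    rw [← hpref]
    have := Real.rpow_nonneg (hlen s).le (powL n + powR n - 4)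
    have := Real.rpow_nonneg (hlen s').le (-((d + 1 : ℕ) : ℝ))
    positivity
  have hCle : ((ℓ : ℝ) + 1) ^ (4 : ℝ) * ((ℓ : ℝ) + 1) ^ ((d + 1 : ℕ) : ℝ) * ((ℓ : ℝ) + 1) ^ (2 : ℝ) * cL ^ 3 ≤ Cg := by rw [hCg]; linarith
  calc fineEntryS i (P349Y i parS Gp) U s s' n
      ≤ comp3 (modelK₁ i B₀ δ₀ n) (modelK₂ i B₁ δ₁) (modelK₃ i B₀ δ₀ n) s s' := hdict
    _ ≤ |comp3 (modelK₁ i B₀ δ₀ n) (modelK₂ i B₁ δ₁) (modelK₃ i B₀ δ₀ n) s s'| := le_abs_self _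
    _ ≤ B₀ * B₁ * B₀ * ((ℓ : ℝ) + 1) ^ (4 : ℝ) * ((ℓ : ℝ) + 1) ^ ((d + 1 : ℕ) : ℝ) * ((ℓ : ℝ) + 1) ^ (2 : ℝ) * cL ^ 3 *
          lenB i s ^ (powL n + powR n - 4) * lenB i s' ^ (-((d + 1 : ℕ) : ℝ)) * Real.exp (-((1 - 1 / 2) * δ * distB i s s')) := main
    _ = B₀ * B₁ * B₀ * (((ℓ : ℝ) + 1) ^ (4 : ℝ) * ((ℓ : ℝ) + 1) ^ ((d + 1 : ℕ) : ℝ) * ((ℓ : ℝ) + 1) ^ (2 : ℝ) * cL ^ 3) *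
          (B9.pref4inv (lenB i s) n * lenB i s' ^ (-((d + 1 : ℕ) : ℝ)) * Real.exp (-(1 / 2 * δ * distB i s s'))) := by
        rw [hpref, hrate]; ring
    _ ≤ B₀ * B₁ * B₀ * Cg * (B9.pref4inv (lenB i s) n * lenB i s' ^ (-((d + 1 : ℕ) : ℝ)) * Real.exp (-(1 / 2 * δ * distB i s s'))) := by
        have hBBB : 0 ≤ B₀ * B₁ * B₀ := by positivity
        exact mul_le_mul_of_nonneg_right (mul_le_mul_of_nonneg_left hCle hBBB) hrest
    _ = _ := by ring

end

end Literature.MathematicalPhysics.QuantumFieldTheory.Balaban1983to89.B9Ineq349SiteThresholdRate
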